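import Literature.NumberTheory.GaloisRepresentations.LubinTateComparisonAddPoints
import Literature.NumberTheory.GaloisRepresentations.LubinTateUnramifiedRelativeGalois
import HarnessLib

set_option autoImplicit false

/-!
# `q = 2`: the comparison `ϑ : Ĝ_m → F_{f'}` carries the PRIMITIVE `2^{n+1}`-th roots of unity (minus one) onto
# primitive `f'`-division points of level `n+1`, i.e. onto the Galois translates `σ_w(ω_{n+1})` of the coherent point

Topic `NumberTheory/GaloisRepresentations`; namespace `Literature.NumberTheory.GaloisRepresentations`.

de Shalit, *Iwasawa theory of elliptic curves with complex multiplication* (1987), I.3.2 (p. 16–17): with an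
isomorphism `θ : Ĝ_m ≃ F_f` over `𝒪̂_{K^nr}` ((3)) one has `f ∘ θ = θ^φ ∘ [p]` ((4)) and, fixing primitive `p^n`-th
roots of unity `ζ_n`, "(5) `ω_n = θ^{φ^{−n}}(ζ_n − 1)` … we see that `ω_n ∈ W̃^n_{φ^{−n}f}` … Thus `(ω_n)` is a generator of
the Tate module of `F_f` in the sense of 2.2."  Here `p = 2`, `F` is a local field with `|𝓀_F| = 2` in which `2` is a
uniformiser (`f₀ = 2X + X²`, `F_{f₀} = Ĝ_m`), `f' = π'X + X²` with `π' = u·2`, and `ϑ = compSeriesC h2 hσ₀ u hε` is the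
tree's concrete comparison series evaluated on the open unit ball `𝔪_ℂ ⊂ 𝒪_{ℂ_F}`.  This file proves the torsion half
of (5) at every finite level:

* `aeval_ltPolyIter_two`, `coe_evalPt₁_homC_two_pow` — `f₀^{(m)} = (1 + X)^{2^m} − 1`, so `[2^m]_{f₀}(t) = (1+t)^{2^m} − 1`;
  `evalPt₁_homC_unit_mul_two_pow` — `[π'^m]_{f₀} = [u^m]_{f₀} ∘ [2^m]_{f₀}`.
* ★ `aeval_ltPolyIter_compSeriesC_eq_zero` / ★ `aeval_ltPolyIter_compSeriesC_ne_zero` — for `t ∈ 𝔪_ℂ` with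
  `(1+t)^{2^{n+1}} = 1` (resp. `(1+t)^{2^n} ≠ 1`): `f'^{(n+1)}(ϑ t) = 0` (resp. `f'^{(n)}(ϑ t) ≠ 0`) — Lubin–Tate's
  `ϑ ∘ [a]_{f₀} = [a]_{f'} ∘ ϑ` ((18)) at `a = π'^m`, `[π'^m]_{f'} = f'^{(m)}`, and the injectivity of `ϑ` on `𝔪_ℂ`;
  ★ `aeval_ltPolyDiv_compSeriesC_eq_zero` — hence `φ_{n+1}(ϑ t) = 0` (`φ_{n+1} = f'^{(n+1)}/f'^{(n)}`): `ϑ t` is a PRIMITIVE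
  division point of level `n+1`.
* `algClosureToC_aeval` — `F̄ → ℂ_F` commutes with evaluation of `F`-polynomials.
* ★★ `exists_unit_coe_compSeriesC_eq_mapPt_cohPt` — **for `1 + t` a primitive `2^{n+1}`-th root of unity in `ℂ_F` and any
  finite normal `E ⊆ F^{nr}`, there is a unit `w ∈ 𝒪_F^×` with `ϑ(t) = σ_w(ι ω_{n+1})` in `𝒪_{ℂ_F}`**, where `ω_{n+1}`
  (`cohPt`) is the coherent primitive division point of `E·F_{π'}^{n+1}` and `σ_w ∈ Gal(E·F_{π'}^{n+1}/E)` realises `w`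
  (`relGalOfUnit`): `ϑ t` is algebraic by the root count (`exists_algClosureToC_eq_of_aeval_eq_zero`), a unit multiple
  of the generator (`exists_unit_ltAct_genPt_eq`), and `σ_w([a]λ′) = [w a]λ′` (`mapPt_relGalOfUnit_relAct`).

Everything is proved; no named facts, no definitions, no instances beyond the topic's standard local-instance
preamble, no `sorry`.

## References

* [deShalit1987] E. de Shalit, *Iwasawa theory of elliptic curves with complex multiplication* (1987), I.3.2 (3)–(5)
  (p. 16–17), I §1.8, I §2.2.
* [LubinTate1965] J. Lubin, J. Tate, *Formal complex multiplication in local fields*, Ann. of Math. 81 (1965), §1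
  Thm. 1 (9), Lemma p. 385, (17)–(18).
* [CasselsFrohlichANT1967] J.-P. Serre, *Local class field theory*, Ch. VI of Cassels–Fröhlich (1967), §3.6 Prop. 6.
* [SerreLocalFields1979] J.-P. Serre, *Local Fields*, Ch. II §2 Cor. 3.
-/

noncomputable section

open MvPowerSeries
open scoped PowerSeries.WithPiTopology

namespace Literature.NumberTheory.GaloisRepresentations

section TorsionPacketTwo

open ValuativeRel IsLocalRing Field IsNonarchimedeanLocalField LubinTate
open Literature.NumberTheory.PAdicHodge

variable {F : Type} [Field F] [ValuativeRel F] [TopologicalSpace F] [IsNonarchimedeanLocalField F]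

attribute [local instance] ltNormUniformSpace ltNormIsUniformAddGroup rk1 nF nE fintypeResidueField

variable (hq : residueFieldCard F = 2)

include hq in
/-- At `|𝓀_F| = 2`: `f₀^{(m)}(x) = (1 + x)^{2^m} − 1` for `f₀ = 2X + X²` (the iterates of `(1+X)² − 1`). [cite: deShalit1987, I.3.2 (3)–(4) (p. 16)] -/
theorem aeval_ltPolyIter_two {B : Type*} [CommRing B] [Algebra F B] (m : ℕ) (x : B) :
    Polynomial.aeval x ((ltPolyIter F ((2 : ℕ) : 𝒪[F]) m).map (algebraMap 𝒪[F] F)) = (1 + x) ^ 2 ^ m - 1 := by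
  induction m with
  | zero => simp [ltPolyIter_zero]
  | succ m ih =>
    rw [ltPolyIter_succ, Polynomial.map_comp, Polynomial.aeval_comp, ih, ltPoly, hq]
    rw [Polynomial.map_add, Polynomial.map_mul, Polynomial.map_pow, Polynomial.map_C, Polynomial.map_X,
      Polynomial.aeval_add, Polynomial.aeval_mul, Polynomial.aeval_C, Polynomial.aeval_X_pow, Polynomial.aeval_X,
      map_natCast, map_natCast]
    ring

variable (h2 : (valuation F).IsUniformizer (((2 : ℕ) : 𝒪[F]) : F)) (u : 𝒪[F]ˣ)
variable {σ₀ : absoluteGaloisGroup F} (hσ₀ : IsAbsArithFrob σ₀)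
variable {ε : (maxUnramifiedCompletion F)ˣ}
  (hε : maxUnramifiedCompletion.galAut F σ₀ (ε : maxUnramifiedCompletion F) =
    algebraMap 𝒪[F] (maxUnramifiedCompletion F) (u : 𝒪[F]) * (ε : maxUnramifiedCompletion F))

include hq in
/-- `[2^m]_{f₀}(t) = (1 + t)^{2^m} − 1` on `𝔪_ℂ` (`f₀ = 2X + X²` is `Ĝ_m`). [cite: deShalit1987, I.3.2 (3)–(4) (p. 16)] -/
theorem coe_evalPt₁_homC_two_pow (m : ℕ) (t : (maxNilIdealC F).toIdeal) :
    (((evalPt₁ (maxNilIdealC F) (homC h2 (((2 : ℕ) : 𝒪[F]) ^ m)) (constantCoeff_homC h2 _) t :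
        (maxNilIdealC F).toIdeal) : CBall F) : CompletedAlgClosure F) =
      (1 + ((t : CBall F) : CompletedAlgClosure F)) ^ 2 ^ m - 1 := by
  rw [coe_evalPt₁_homC_pow h2 m t, aeval_ltPolyIter_two hq m]

/-- `[π'^m]_{f₀} = [u^m]_{f₀} ∘ [2^m]_{f₀}` on `𝔪_ℂ` (`π' = u·2`). [cite: LubinTate1965, §1 Thm. 1 (9)] -/
theorem evalPt₁_homC_unit_mul_two_pow (m : ℕ) (t : (maxNilIdealC F).toIdeal) :
    evalPt₁ (maxNilIdealC F) (homC h2 ((((u : 𝒪[F]) * ((2 : ℕ) : 𝒪[F]) : 𝒪[F])) ^ m)) (constantCoeff_homC h2 _) t =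
      evalPt₁ (maxNilIdealC F) (homC h2 ((u : 𝒪[F]) ^ m)) (constantCoeff_homC h2 _)
        (evalPt₁ (maxNilIdealC F) (homC h2 (((2 : ℕ) : 𝒪[F]) ^ m)) (constantCoeff_homC h2 _) t) := by
  rw [← evalPt₁_homC_mul h2]
  exact evalPt_congr (maxNilIdealC F) (by rw [mul_pow]) _ _ _

include hq in
/-- ★ **`ϑ` carries the `2^{n+1}`-torsion of `Ĝ_m` into the `f'^{(n+1)}`-torsion of `F_{f'}`**:
`(1 + t)^{2^{n+1}} = 1 ⟹ f'^{(n+1)}(ϑ t) = 0`. [cite: LubinTate1965, Lemma p. 385, (18)] [cite: deShalit1987, I.3.2 (5) (p. 17)] -/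
theorem aeval_ltPolyIter_compSeriesC_eq_zero (n : ℕ) (t : (maxNilIdealC F).toIdeal)
    (ht : (1 + ((t : CBall F) : CompletedAlgClosure F)) ^ 2 ^ (n + 1) = 1) :
    Polynomial.aeval (((evalPt₁ (maxNilIdealC F) (compSeriesC h2 hσ₀ u hε) (constantCoeff_compSeriesC h2 hσ₀ u hε) t :
        (maxNilIdealC F).toIdeal) : CBall F) : CompletedAlgClosure F)
      ((ltPolyIter F ((u : 𝒪[F]) * ((2 : ℕ) : 𝒪[F])) (n + 1)).map (algebraMap 𝒪[F] F)) = 0 := by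
  -- `[2^{n+1}]_{f₀} t = 0`
  have h0 : evalPt₁ (maxNilIdealC F) (homC h2 (((2 : ℕ) : 𝒪[F]) ^ (n + 1))) (constantCoeff_homC h2 _) t = 0 := by
    apply Subtype.ext; apply Subtype.ext
    rw [coe_evalPt₁_homC_two_pow hq h2 (n + 1) t, ht, sub_self]; rfl
  -- `[π'^{n+1}]_{f₀} t = 0`
  have h1 : evalPt₁ (maxNilIdealC F) (homC h2 ((((u : 𝒪[F]) * ((2 : ℕ) : 𝒪[F]) : 𝒪[F])) ^ (n + 1)))
      (constantCoeff_homC h2 _) t = 0 := by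
    rw [evalPt₁_homC_unit_mul_two_pow h2 u (n + 1) t, h0, LubinTate.evalPt₁_zero]
  -- `[π'^{n+1}]_{f'} (ϑ t) = ϑ([π'^{n+1}]_{f₀} t) = 0`
  have h3 := evalPt₁_compSeriesC_homC h2 hσ₀ u hε ((((u : 𝒪[F]) * ((2 : ℕ) : 𝒪[F]) : 𝒪[F])) ^ (n + 1)) t
  rw [h1, LubinTate.evalPt₁_zero] at h3
  -- read through `coe_evalPt₁_homC_pow` for the uniformiser `π'`
  have h4 := coe_evalPt₁_homC_pow (isUniformizer_unit_mul h2 u) (n + 1)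
    (evalPt₁ (maxNilIdealC F) (compSeriesC h2 hσ₀ u hε) (constantCoeff_compSeriesC h2 hσ₀ u hε) t)
  rw [← h4]
  change ((((evalPt₁ (maxNilIdealC F) (homC' h2 u ((((u : 𝒪[F]) * ((2 : ℕ) : 𝒪[F]) : 𝒪[F])) ^ (n + 1)))
      (constantCoeff_homC' h2 u _)
      (evalPt₁ (maxNilIdealC F) (compSeriesC h2 hσ₀ u hε) (constantCoeff_compSeriesC h2 hσ₀ u hε) t) :
        (maxNilIdealC F).toIdeal) : CBall F) : CompletedAlgClosure F)) = 0
  rw [← h3]; rfl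

include hq in
/-- ★ **… and primitive torsion to primitive torsion**: `(1 + t)^{2^n} ≠ 1 ⟹ f'^{(n)}(ϑ t) ≠ 0` (`ϑ` is injective on
`𝔪_ℂ`, `[u]_{f₀}` is invertible). [cite: LubinTate1965, Lemma p. 385, (18)] [cite: deShalit1987, I.3.2 (5) (p. 17)] -/
theorem aeval_ltPolyIter_compSeriesC_ne_zero (n : ℕ) (t : (maxNilIdealC F).toIdeal)
    (ht : (1 + ((t : CBall F) : CompletedAlgClosure F)) ^ 2 ^ n ≠ 1) :
    Polynomial.aeval (((evalPt₁ (maxNilIdealC F) (compSeriesC h2 hσ₀ u hε) (constantCoeff_compSeriesC h2 hσ₀ u hε) t :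
        (maxNilIdealC F).toIdeal) : CBall F) : CompletedAlgClosure F)
      ((ltPolyIter F ((u : 𝒪[F]) * ((2 : ℕ) : 𝒪[F])) n).map (algebraMap 𝒪[F] F)) ≠ 0 := by
  intro h
  apply ht
  -- `[π'^n]_{f'} (ϑ t) = 0`
  have h4 := coe_evalPt₁_homC_pow (isUniformizer_unit_mul h2 u) n
    (evalPt₁ (maxNilIdealC F) (compSeriesC h2 hσ₀ u hε) (constantCoeff_compSeriesC h2 hσ₀ u hε) t)
  rw [h] at h4
  have h5 : evalPt₁ (maxNilIdealC F) (homC' h2 u ((((u : 𝒪[F]) * ((2 : ℕ) : 𝒪[F]) : 𝒪[F])) ^ n))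
      (constantCoeff_homC' h2 u _)
      (evalPt₁ (maxNilIdealC F) (compSeriesC h2 hσ₀ u hε) (constantCoeff_compSeriesC h2 hσ₀ u hε) t) = 0 := by
    apply Subtype.ext; apply Subtype.ext
    exact h4
  -- `ϑ([π'^n]_{f₀} t) = 0 = ϑ 0`, so `[π'^n]_{f₀} t = 0`
  have h3 := evalPt₁_compSeriesC_homC h2 hσ₀ u hε ((((u : 𝒪[F]) * ((2 : ℕ) : 𝒪[F]) : 𝒪[F])) ^ n) t
  rw [h5, ← LubinTate.evalPt₁_zero (maxNilIdealC F) (compSeriesC h2 hσ₀ u hε) (constantCoeff_compSeriesC h2 hσ₀ u hε)] at h3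
  have h6 := evalPt₁_injective _ (constantCoeff_compSeriesC h2 hσ₀ u hε) (isUnit_coeff_one_compSeriesC h2 hσ₀ u hε) h3
  rw [evalPt₁_homC_unit_mul_two_pow h2 u n t] at h6
  -- cancel `[u^n]_{f₀}` with `[u^{-n}]_{f₀}`
  have h7 : evalPt₁ (maxNilIdealC F) (homC h2 (((2 : ℕ) : 𝒪[F]) ^ n)) (constantCoeff_homC h2 _) t = 0 := by
    have h8 := congrArg (evalPt₁ (maxNilIdealC F) (homC h2 (((u⁻¹ : 𝒪[F]ˣ) : 𝒪[F]) ^ n)) (constantCoeff_homC h2 _)) h6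
    rw [LubinTate.evalPt₁_zero, ← evalPt₁_homC_mul h2, ← mul_pow, Units.inv_mul, one_pow, evalPt₁_homC_one] at h8
    exact h8
  have h9 := congrArg (fun P : (maxNilIdealC F).toIdeal => ((P : CBall F) : CompletedAlgClosure F)) h7
  simp only [coe_evalPt₁_homC_two_pow hq h2 n t] at h9
  rw [sub_eq_iff_eq_add] at h9
  rw [h9]
  exact zero_add 1

include hq in
/-- ★ Hence **`φ_{n+1}(ϑ t) = 0`** (`φ_{n+1} = f'^{(n+1)}/f'^{(n)}`): for `1 + t` a PRIMITIVE `2^{n+1}`-th root of unity,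
`ϑ t` is a PRIMITIVE `f'`-division point of level `n + 1` (de Shalit's `ω_n ∈ W̃^n`). [cite: deShalit1987, I.3.2 (5) (p. 17)] [cite: CasselsFrohlichANT1967, Ch. VI §3.6 Prop. 6 (a)] -/
theorem aeval_ltPolyDiv_compSeriesC_eq_zero (n : ℕ) (t : (maxNilIdealC F).toIdeal)
    (ht₁ : (1 + ((t : CBall F) : CompletedAlgClosure F)) ^ 2 ^ (n + 1) = 1)
    (ht₂ : (1 + ((t : CBall F) : CompletedAlgClosure F)) ^ 2 ^ n ≠ 1) :
    Polynomial.aeval (((evalPt₁ (maxNilIdealC F) (compSeriesC h2 hσ₀ u hε) (constantCoeff_compSeriesC h2 hσ₀ u hε) t :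
        (maxNilIdealC F).toIdeal) : CBall F) : CompletedAlgClosure F)
      ((ltPolyDiv F ((u : 𝒪[F]) * ((2 : ℕ) : 𝒪[F])) n).map (algebraMap 𝒪[F] F)) = 0 := by
  have h := aeval_ltPolyIter_compSeriesC_eq_zero hq h2 u hσ₀ hε n t ht₁
  rw [ltPolyIter_succ_eq_mul, Polynomial.map_mul, map_mul] at h
  exact (mul_eq_zero.mp h).resolve_left (aeval_ltPolyIter_compSeriesC_ne_zero hq h2 u hσ₀ hε n t ht₂)

omit [IsNonarchimedeanLocalField F] in
/-- `algClosureToC` commutes with polynomial evaluation over `F`. [cite: SerreLocalFields1979, Ch. II §2 Cor. 3] -/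
theorem algClosureToC_aeval [IsNonarchimedeanLocalField F] (y : AlgebraicClosure F) (P : Polynomial F) :
    algClosureToC F (Polynomial.aeval y P) = Polynomial.aeval (algClosureToC F y) P := by
  have hcomp : (algebraMap F (CompletedAlgClosure F)).comp (RingHom.id F) =
      (algClosureToC F).comp (algebraMap F (AlgebraicClosure F)) :=
    RingHom.ext fun a => (algClosureToC_algebraMap a).symm
  rw [Polynomial.map_aeval_eq_aeval_map hcomp, Polynomial.map_id]

variable (E : IntermediateField F (AlgebraicClosure F)) [FiniteDimensional F E] [Normal F E] (hE : E ≤ maxUnramified F)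

include hq in
/-- ★★ **TORSION-PACKET MATCHING**: if `1 + t ∈ ℂ_F` is a primitive `2^{n+1}`-th root of unity then
`ϑ(t) = σ_w(ω_{n+1})` in `𝒪_ℂ` for some unit `w ∈ 𝒪_F^×` — the comparison isomorphism carries the primitive `2^{n+1}`-torsion
packet of `Ĝ_m` onto the `Gal(E·F_{π'}^{n+1}/E)`-orbit of de Shalit's coherent division point (`ϑ t` is algebraic by the root
count `exists_algClosureToC_eq_of_aeval_eq_zero`, a unit multiple of the generator by `exists_unit_ltAct_genPt_eq`, and the
relative Galois group realises every unit, `mapPt_relGalOfUnit_relAct`). [cite: deShalit1987, I.3.2 (5) (p. 17), I §1.8] [cite: CasselsFrohlichANT1967, Ch. VI §3.6 Prop. 6] -/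
theorem exists_unit_coe_compSeriesC_eq_mapPt_cohPt (n : ℕ) (t : (maxNilIdealC F).toIdeal)
    (ht₁ : (1 + ((t : CBall F) : CompletedAlgClosure F)) ^ 2 ^ (n + 1) = 1)
    (ht₂ : (1 + ((t : CBall F) : CompletedAlgClosure F)) ^ 2 ^ n ≠ 1) :
    ∃ w : 𝒪[F]ˣ,
      ((evalPt₁ (maxNilIdealC F) (compSeriesC h2 hσ₀ u hε) (constantCoeff_compSeriesC h2 hσ₀ u hε) t :
          (maxNilIdealC F).toIdeal) : CBall F) =
        unitBallToCBall (E ⊔ ltField ((u : 𝒪[F]) * ((2 : ℕ) : 𝒪[F])) n : IntermediateField F (AlgebraicClosure F))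
          ((mapPt (relGalOfUnit (isUniformizer_unit_mul h2 u) E n hE w)
            (inclPt (le_sup_right : ltField ((u : 𝒪[F]) * ((2 : ℕ) : 𝒪[F])) n ≤
                E ⊔ ltField ((u : 𝒪[F]) * ((2 : ℕ) : 𝒪[F])) n)
              (cohPt (isUniformizer_unit_mul h2 u) n))) :
            unitBall (E ⊔ ltField ((u : 𝒪[F]) * ((2 : ℕ) : 𝒪[F])) n : IntermediateField F (AlgebraicClosure F))) := by
  set hπ' := isUniformizer_unit_mul h2 u with hπ'_def
  obtain ⟨y, hy⟩ := exists_algClosureToC_eq_of_aeval_eq_zero hπ' n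
    (aeval_ltPolyIter_compSeriesC_eq_zero hq h2 u hσ₀ hε n t ht₁)
  have hy' : Polynomial.aeval (y : AlgebraicClosure F)
      ((ltPolyDiv F ((u : 𝒪[F]) * ((2 : ℕ) : 𝒪[F])) n).map (algebraMap 𝒪[F] F)) = 0 := by
    apply (algClosureToC F).injective
    rw [map_zero, algClosureToC_aeval, hy]
    exact aeval_ltPolyDiv_compSeriesC_eq_zero hq h2 u hσ₀ hε n t ht₁ ht₂
  obtain ⟨w, hw⟩ := exists_unit_ltAct_genPt_eq hπ' n hy'
  refine ⟨w * (cohUnit hπ' n)⁻¹, Subtype.ext ?_⟩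
  rw [coe_unitBallToCBall, cohPt_eq, inclPt_ltAct_genPt, mapPt_relGalOfUnit_relAct,
    show ((w * (cohUnit hπ' n)⁻¹ : 𝒪[F]ˣ) : 𝒪[F]) * (cohUnit hπ' n : 𝒪[F]) = (w : 𝒪[F]) by
      rw [Units.val_mul, mul_assoc, Units.inv_mul, mul_one],
    coe_relAct_relGenPt, hw, hy]

end TorsionPacketTwo

end Literature.NumberTheory.GaloisRepresentations

end
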